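import Summits.CriticalPhenomena.PercolationContinuityZ3.Theorems.SahiConjectureProduct
import Literature.Combinatorics.Sahi2008.UniformCube
import Literature.Combinatorics.Sahi2008.Indicators

/-!
# Sahi's `C_n` ⟺ `C_n` for the uniform cubes `{0,1}^M`; Kahn's Conjecture 5 as a counting inequality

Companion of `SahiConjecture.lean` / `SahiConjectureProduct.lean` (cell `prim-sahi`, typer;
`--supports stmt-CriticalPhenomena-4575`).  By `SahiConjectureProduct.lean` the obligation
`SahiConjecture n` is equivalent to its product-measure case; by
`Literature.Combinatorics.Sahi2008.SahiPositive.of_isFKGMeasure_of_forall_uniform`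
(`Literature/Combinatorics/Sahi2008/UniformCube.lean`: dyadic threshold coins are monotone images of
fair coins, and `E_n` is continuous in the weight — the discretise-and-pass-to-the-limit step of
[LiebSahi2021, Lemma 2.3]) it is further equivalent to the UNIFORM case: the fair-coin weight `2^{-M}`
on `{0,1}^M` for every `M`.  This is the setting of Lieb–Sahi's theorems (Lebesgue measure on
`[0,1]^k`, [LiebSahi2021, §2]) and of Gladkov–Zimin's cube-poset form [GladkovZimin2024, Conj. 2.6].

* `sahiConjecture_iff_forall_uniformWeight n` / `…_fin n` — `SahiConjecture n ↔` every uniform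
  weight on a finite cube (`ι → Bool`, resp. `Fin M → Bool`) is Sahi-positive of order `n`.
* `kahnConjecture_iff_counting` — for `n = 3`, with the layer cake: **Kahn's Conjecture 5 is
  equivalent to the pure counting inequality**
  `2^M (|A||B∩C| + |B||A∩C| + |C||A∩B|) ≤ 2·4^M |A∩B∩C| + |A||B||C|`
  for all up-sets `A, B, C ⊆ {0,1}^M` and all `M` (multiply Kahn's display by `2^{3M}`).

Nothing here asserts either conjecture (both remain `[status: open]`).
-/

noncomputable section

namespace Summit.CriticalPhenomena.PercolationContinuityZ3.Theorems

open Finset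
open Literature.Combinatorics.Sahi2008

/-- **`C_n` ⟺ `C_n` for the uniform cubes**: `SahiConjecture n ↔` for every finite `ι : Type` the
fair-coin weight on `ι → Bool` is Sahi-positive of order `n`.  (→: the uniform weight is an FKG poset,
`isFKGMeasure_uniformWeight`; ←: `SahiPositive.of_isFKGMeasure_of_forall_uniform`.)
[cite: LiebSahi2021, §2 (Lebesgue setting) and Lemma 2.3; Kahn2022, pp. 2–3] -/
theorem sahiConjecture_iff_forall_uniformWeight (n : ℕ) :
    SahiConjecture n ↔
      ∀ (ι : Type) [Fintype ι] [DecidableEq ι], SahiPositive (uniformWeight ι) n :=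
  ⟨fun hC ι _ _ => hC (ι → Bool) (uniformWeight ι) isFKGMeasure_uniformWeight,
    fun h _ _ _ _ hμ => SahiPositive.of_isFKGMeasure_of_forall_uniform h hμ⟩

/-- The same with the cubes `{0,1}^M = (Fin M → Bool)` only. [cite: LiebSahi2021, §2 and Lemma 2.3; Kahn2022, pp. 2–3] -/
theorem sahiConjecture_iff_forall_uniformWeight_fin (n : ℕ) :
    SahiConjecture n ↔ ∀ M : ℕ, SahiPositive (uniformWeight (Fin M)) n :=
  ⟨fun hC M => (sahiConjecture_iff_forall_uniformWeight n).1 hC (Fin M),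
    fun h => (sahiConjecture_iff_forall_uniformWeight n).2 fun ι _ _ =>
      SahiPositive.uniformWeight_of_forall_fin h ι⟩

/-- The full hierarchy in uniform form. [cite: LiebSahi2021, Conj. 1.1 and §2; Kahn2022, pp. 2–3] -/
theorem forall_sahiConjecture_iff_forall_uniformWeight_fin :
    (∀ n, SahiConjecture n) ↔ ∀ (n M : ℕ), SahiPositive (uniformWeight (Fin M)) n :=
  forall_congr' fun n => sahiConjecture_iff_forall_uniformWeight_fin n

/-! ### `n = 3`: Kahn's Conjecture 5 as a counting inequality on `{0,1}^M` -/

/-- `E[1_A]` under the uniform weight is `|A| / 2^{|ι|}`.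
[cite: LiebSahi2021, §2.1 (`E_1(a) = (a_1+⋯+a_m)/m²`, the uniform normalisation)] -/
theorem ex_uniformWeight_setInd {ι : Type} [Fintype ι] [DecidableEq ι] (A : Finset (ι → Bool)) :
    ex (uniformWeight ι) (setInd A) = (A.card : ℝ) / 2 ^ Fintype.card ι := by
  rw [ex]
  simp only [uniformWeight_apply, setInd_apply, mul_ite, mul_one, mul_zero]
  rw [sum_ite_mem, univ_inter, sum_const, nsmul_eq_mul]
  ring

/-- Sahi's `E_3` of three indicator functions under the uniform weight on `{0,1}^ι`, as a counting
expression: `E_3(1_A,1_B,1_C) = (2N²|ABC| + |A||B||C| − N(|A||BC| + |B||AC| + |C||AB|)) / N³`,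
`N = 2^{|ι|}`. [cite: LiebSahi2021, eq. (2.1) and §2.1; Sahi2008, p. 213] -/
theorem sahiE_three_setInd_uniformWeight {ι : Type} [Fintype ι] [DecidableEq ι]
    (U : Fin 3 → Finset (ι → Bool)) :
    sahiE (uniformWeight ι) 3 (fun i => setInd (U i)) =
      (2 * (2 ^ Fintype.card ι : ℝ) ^ 2 * ((U 0 ∩ U 1 ∩ U 2).card : ℝ) +
          (U 0).card * (U 1).card * (U 2).card -
        (2 ^ Fintype.card ι : ℝ) * ((U 0).card * ((U 1 ∩ U 2).card : ℝ) +
          (U 1).card * ((U 0 ∩ U 2).card : ℝ) + (U 2).card * ((U 0 ∩ U 1).card : ℝ))) /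
        (2 ^ Fintype.card ι : ℝ) ^ 3 := by
  rw [sahiE_three_apply]
  simp only [setInd_mul, ex_uniformWeight_setInd]
  have hN : (2 : ℝ) ^ Fintype.card ι ≠ 0 := pow_ne_zero _ two_ne_zero
  field_simp

/-- **Kahn's Conjecture 5 ⟺ a counting inequality on the uniform cubes**: for all `M` and all
up-sets `A, B, C ⊆ {0,1}^M` (product order on `Fin M → Bool`),
`2^M (|A||B∩C| + |B||A∩C| + |C||A∩B|) ≤ 2·2^M·2^M |A∩B∩C| + |A||B||C|` — Kahn's display
`2μ(ABC) − [μ(AB)μ(C)+μ(AC)μ(B)+μ(BC)μ(A)] + μ(A)μ(B)μ(C) ≥ 0` for the UNIFORM `μ`, cleared of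
denominators; equivalent to the product-measure statement by `sahiConjecture_three_iff_kahnConjecture`,
`sahiConjecture_iff_forall_uniformWeight_fin` and the layer cake `sahiPositive_iff_indicators`.
[cite: Kahn2022, Conj. 5 (arXiv p. 3); LiebSahi2021, Lemma 2.2 and Lemma 2.3; GladkovZimin2024, Conj. 2.6] -/
theorem kahnConjecture_iff_counting :
    KahnConjecture ↔
      ∀ (M : ℕ) (A B C : Finset (Fin M → Bool)), IsUpperSet (A : Set (Fin M → Bool)) →
        IsUpperSet (B : Set (Fin M → Bool)) → IsUpperSet (C : Set (Fin M → Bool)) →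
        2 ^ M * (A.card * (B ∩ C).card + B.card * (A ∩ C).card + C.card * (A ∩ B).card) ≤
          2 * 2 ^ M * 2 ^ M * (A ∩ B ∩ C).card + A.card * B.card * C.card := by
  rw [← sahiConjecture_three_iff_kahnConjecture, sahiConjecture_iff_forall_uniformWeight_fin]
  refine forall_congr' fun M => ?_
  rw [sahiPositive_iff_indicators]
  -- the sign of `E_3(1_A,1_B,1_C)` is the sign of the cleared numerator
  have key : ∀ U : Fin 3 → Finset (Fin M → Bool),
      0 ≤ sahiE (uniformWeight (Fin M)) 3 (fun i => setInd (U i)) ↔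
        2 ^ M * ((U 0).card * (U 1 ∩ U 2).card + (U 1).card * (U 0 ∩ U 2).card +
            (U 2).card * (U 0 ∩ U 1).card) ≤
          2 * 2 ^ M * 2 ^ M * (U 0 ∩ U 1 ∩ U 2).card + (U 0).card * (U 1).card * (U 2).card := by
    intro U
    rw [sahiE_three_setInd_uniformWeight, Fintype.card_fin]
    have hN : (0 : ℝ) < 2 ^ M := pow_pos two_pos _
    rw [div_nonneg_iff, ← Nat.cast_le (α := ℝ)]
    push_cast
    constructor
    · rintro (⟨h, -⟩ | ⟨-, h⟩)
      · nlinarith [h]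
      · exact absurd h (not_le.2 (pow_pos hN 3))
    · intro h
      exact Or.inl ⟨by nlinarith [h], (pow_pos hN 3).le⟩
  constructor
  · intro h A B C hA hB hC
    have h' := (key ![A, B, C]).1 (h ![A, B, C] fun i => by fin_cases i <;> assumption)
    simpa using h'
  · intro h U hU
    exact (key U).2 (h (U 0) (U 1) (U 2) (hU 0) (hU 1) (hU 2))

end Summit.CriticalPhenomena.PercolationContinuityZ3.Theorems
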